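import Literature.Barriers.CriticalPhenomena.RigorousRGSmallParameterLazyWalk
import Literature.Barriers.CriticalPhenomena.HaraGaussianLemmaLatticeSums
import Mathlib.Analysis.SpecificLimits.Normed
import Mathlib.Algebra.Order.Chebyshev
import HarnessLib

/-!
# `RigorousRGSmallParameter` (Slade, Theorem 1.4.1): Lemma 2.1.1 PROVED — the decay
# `-(-Δ)^β_{0,x} ≍ |x|^{-d-2β}` of the fractional Laplacian on `ℤ^d`

Discharges the named fact `LongRangePhi4.Slade2017_lem211` of
`RigorousRGSmallParameterSusceptibilityFormula.lean`. Source: G. Slade, *Critical exponents for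
long-range `O(n)` models below the upper critical dimension*, CMP 358 (2018), arXiv:1611.06169,
§2.1.1, Lemma 2.1.1 (arXiv p. 9): "For `d ≥ 1` and `β ∈ (0,1)`, as `|x| → ∞`,
`-(-Δ)^β_{0,x} ≍ |x|^{-d-2β}`."

## The printed proof and what is formalised

Printed proof: "By (2.5)–(2.6) and (2.10), it suffices to prove that
`Σ_{n=|x|}^∞ n^{-1-β-d/2} e^{-c|x|²/n} ≍ |x|^{-d-2β}`. For the lower bound we bound the left-hand
side below by `e^{-c} Σ_{n=|x|²}^{2|x|²} n^{-1-β-d/2} ≥ c'|x|^{-d-2β}`. For the upper bound, we use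
`Σ_{n=|x|}^∞ n^{-1-β-d/2} e^{-c|x|²/n} ≤ C∫₀^∞ t^{-1-β-d/2} e^{-c|x|²/t} dt = |x|^{-d-2β} C ∫₀^∞ …`."
Here (2.5) is the binomial series `(-Δ)^β = (2d)^β Σ_n (-1)ⁿ(β choose n) Dⁿ`
(`hasSum_fracLaplacianZd`, `RigorousRGSmallParameterFracLaplacian.lean`), (2.6) the Stirling
asymptotics `(-1)ⁿ(β choose n) ∼ -β/Γ(1-β) n^{-1-β}`, and (2.10) the [GT02] heat kernel bound
for the `n`-step law `pₙ = (Dⁿ)_{0,·}` of simple random walk. This file follows that proof with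
the inputs in the (weaker, sufficient) forms proved in the tree:

* (2.6) as the two-sided bound `c_β n^{-1-β} ≤ -(-1)ⁿ(β choose n) ≤ β n^{-1-β}` (`n ≥ 1`)
  (`le_neg_binomAlt`, `neg_binomAlt_le`; from the product formula `binomAlt_succ` of the tree,
  `P_N ≤ (N+1)^{-β}` there and `P_N ≥ e^{-β/(1-β)-β}(N+1)^{-β}` here (`le_binomPartialProd`), via
  `1 - u ≥ e^{-u/(1-u)}` and `H_N ≤ 1 + log N`);
* (2.10), upper half: the Gaussian bound `pₙ(x) ≤ C n^{-d/2} e^{-x_j²/(8n)}`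
  (`exists_srwLaw_gaussian_upper`, `RigorousRGSmallParameterLazyWalk.lean`), with `j` a largest
  coordinate of `x` (`x_j² ≥ |x|²/d`); the sum `Σ_{n≥1} n^{-γ} e^{-A/n} ≤ K A^{1-γ}`
  (`γ = 1+β+d/2`, `A = x_j²/8 ≥ 1`) is bounded by splitting at `n = ⌊A⌋` — `e^{-u} ≤ (q/e)^q u^{-q}`
  below, the `p`-series tail (`sum_Ico_succ_rpow_le_of_lt`) above — instead of the integral;
* (2.10), lower half, in the window `n ≍ |x|²`: the near-diagonal bound
  `p^L_n(x) ≥ c n^{-d/2}` for the LAZY walk when `|x|₁ ≤ ε√n` (`exists_lazyLaw_ge`), transferred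
  to `Σ_{L ≤ m ≤ 8L} p_m(x) ≥ c L^{1-d/2}` through `Σ_{n=4L}^{8L} p^L_n = Σ_m W_m p_m` with
  binomial weights `W_m ≤ 2` (`sum_range_choose_div_two_pow_le_two`) that are exponentially small
  for `m < L` (`choose_div_two_pow_le`: `(n choose m)2^{-n} ≤ (48/81)^L`); this replaces the
  parity bookkeeping "for `n` and `x` of the same parity" of the pointwise [GT02] lower bound.

Main results: `exists_neg_fracLaplacianZd_le` (upper bound), `exists_le_neg_fracLaplacianZd`
(lower bound), **`Slade2017_lem211_holds : Slade2017_lem211`**.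
-/

noncomputable section

namespace Literature.Barriers.CriticalPhenomena

open _root_.MeasureTheory Finset Filter Literature.Probability.LatticeModels
open scoped _root_.Topology BigOperators Nat

namespace LongRangePhi4

variable {d : ℕ}

/-! ### (2.6): two-sided power bounds on `-(-1)ⁿ(β choose n)` -/

/-- `Σ_{j<N} β/(j+1-β) ≤ β/(1-β) + β + β log(N+1)` for `0 ≤ β < 1` (first term apart, the rest is
`≤ β H_{N-1} ≤ β(1 + log(N-1))`). [folklore] -/
theorem sum_div_sub_le_log {β : ℝ} (hβ0 : 0 ≤ β) (hβ1 : β < 1) (N : ℕ) :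
    ∑ j ∈ Finset.range N, β / ((j : ℝ) + 1 - β) ≤
      β / (1 - β) + β + β * Real.log ((N : ℝ) + 1) := by
  have h1β : 0 < 1 - β := by linarith
  rcases N with _ | M
  · simp only [Finset.range_zero, Finset.sum_empty, Nat.cast_zero, zero_add, Real.log_one, mul_zero,
      add_zero]
    positivity
  rw [Finset.sum_range_succ']
  simp only [Nat.cast_add, Nat.cast_one, CharP.cast_eq_zero, zero_add]
  -- the shifted terms: `β/(j+2-β) ≤ β/(j+1)`
  have hM : ∑ j ∈ Finset.range M, β / ((j : ℝ) + 1 + 1 - β) ≤ β * ∑ j ∈ Finset.range M, ((j : ℝ) + 1)⁻¹ := by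
    rw [Finset.mul_sum]
    refine Finset.sum_le_sum fun j _ => ?_
    rw [← div_eq_mul_inv]
    exact div_le_div_of_nonneg_left hβ0 (by positivity) (by linarith)
  -- harmonic bound
  have hH : ∑ j ∈ Finset.range M, ((j : ℝ) + 1)⁻¹ ≤ 1 + Real.log M := by
    have h := harmonic_le_one_add_log M
    simp only [harmonic] at h
    push_cast at h
    exact h
  have hlog : Real.log M ≤ Real.log ((M : ℝ) + 1 + 1) := by
    rcases Nat.eq_zero_or_pos M with hM0 | hMpos
    · subst hM0
      simp only [Nat.cast_zero, Real.log_zero, zero_add]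
      exact Real.log_nonneg (by norm_num)
    · exact Real.log_le_log (by exact_mod_cast hMpos) (by linarith)
  have e0 : β / (1 - β) = β / ((0 : ℝ) + 1 - β) := by ring_nf
  calc ∑ j ∈ Finset.range M, β / ((j : ℝ) + 1 + 1 - β) + β / (1 - β)
      ≤ β * (1 + Real.log M) + β / (1 - β) := by
        have := hM.trans (mul_le_mul_of_nonneg_left hH hβ0)
        linarith
    _ ≤ β / (1 - β) + β + β * Real.log ((M : ℝ) + 1 + 1) := by
        have := mul_le_mul_of_nonneg_left hlog hβ0
        linarith

/-- **Lower bound on the partial products**: `P_N = Π_{j<N}(1 - β/(j+1)) ≥ e^{-β/(1-β)-β}(N+1)^{-β}`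
for `0 ≤ β < 1`. [folklore] -/
theorem le_binomPartialProd {β : ℝ} (hβ0 : 0 ≤ β) (hβ1 : β < 1) (N : ℕ) :
    Real.exp (-(β / (1 - β) + β)) * ((N : ℝ) + 1) ^ (-β) ≤ binomPartialProd β N := by
  have hN : (0 : ℝ) < (N : ℝ) + 1 := by positivity
  -- factorwise `1 - u ≥ e^{-u/(1-u)}` (`u = β/(j+1)`), from `1 + y ≤ e^y` at `y = u/(1-u)`
  have hfac : ∀ j : ℕ, Real.exp (-(β / ((j : ℝ) + 1 - β))) ≤ 1 - β / ((j : ℝ) + 1) := by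
    intro j
    have hj : (0 : ℝ) < (j : ℝ) + 1 := by positivity
    have hj0 : (0 : ℝ) ≤ j := Nat.cast_nonneg j
    set u : ℝ := β / ((j : ℝ) + 1) with hu
    have hu1 : u < 1 := by
      rw [hu, div_lt_one hj]
      linarith
    have h1u : 0 < 1 - u := by linarith
    have h := Real.add_one_le_exp (u / (1 - u))
    have e1 : u / (1 - u) + 1 = (1 - u)⁻¹ := by
      field_simp
      ring
    rw [e1] at h
    have h' : Real.exp (-(u / (1 - u))) ≤ 1 - u := by
      rw [Real.exp_neg, inv_le_comm₀ (Real.exp_pos _) h1u]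
      exact h
    have hne : (j : ℝ) + 1 - β ≠ 0 := by linarith
    have e : u / (1 - u) = β / ((j : ℝ) + 1 - β) := by
      rw [hu]
      field_simp
    rwa [e] at h'
  have h1 : Real.exp (-(∑ j ∈ Finset.range N, β / ((j : ℝ) + 1 - β))) ≤ binomPartialProd β N := by
    unfold binomPartialProd
    rw [← Finset.sum_neg_distrib, Real.exp_sum]
    exact Finset.prod_le_prod (fun j _ => (Real.exp_pos _).le) (fun j _ => hfac j)
  refine le_trans ?_ h1
  have h2 := sum_div_sub_le_log hβ0 hβ1 N
  rw [Real.rpow_def_of_pos hN, ← Real.exp_add, Real.exp_le_exp]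
  linarith

/-- `-a_{N+1} = (β/(N+1)) P_N`. [folklore] -/
theorem neg_binomAlt_succ (β : ℝ) (N : ℕ) :
    -binomAlt β (N + 1) = β / ((N : ℝ) + 1) * binomPartialProd β N := by
  rw [binomAlt_succ]
  ring

/-- **(2.6), upper half**: `-(-1)ⁿ(β choose n) ≤ β n^{-1-β}` for `n ≥ 1`, `0 ≤ β < 1`.
[cite: Slade2017, §2.1.1 display (2.6)] -/
theorem neg_binomAlt_le {β : ℝ} (hβ0 : 0 ≤ β) (hβ1 : β < 1) {n : ℕ} (hn : 1 ≤ n) :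
    -binomAlt β n ≤ β * (n : ℝ) ^ (-(1 + β)) := by
  obtain ⟨N, rfl⟩ : ∃ N, n = N + 1 := ⟨n - 1, by omega⟩
  rw [neg_binomAlt_succ]
  have hN : (0 : ℝ) < (N : ℝ) + 1 := by positivity
  have hP := binomPartialProd_le hβ0 hβ1 N
  have e : ((N + 1 : ℕ) : ℝ) = (N : ℝ) + 1 := by push_cast; ring
  rw [e]
  calc β / ((N : ℝ) + 1) * binomPartialProd β N ≤ β / ((N : ℝ) + 1) * ((N : ℝ) + 1) ^ (-β) :=
        mul_le_mul_of_nonneg_left hP (by positivity)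
    _ = β * ((N : ℝ) + 1) ^ (-(1 + β)) := by
        rw [show -(1 + β) = -1 + -β by ring, Real.rpow_add hN, Real.rpow_neg_one]
        ring

/-- **(2.6), lower half**: `-(-1)ⁿ(β choose n) ≥ β e^{-β/(1-β)-β} n^{-1-β}` for `n ≥ 1`,
`0 ≤ β < 1`. [cite: Slade2017, §2.1.1 display (2.6)] -/
theorem le_neg_binomAlt {β : ℝ} (hβ0 : 0 ≤ β) (hβ1 : β < 1) {n : ℕ} (hn : 1 ≤ n) :
    β * Real.exp (-(β / (1 - β) + β)) * (n : ℝ) ^ (-(1 + β)) ≤ -binomAlt β n := by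
  obtain ⟨N, rfl⟩ : ∃ N, n = N + 1 := ⟨n - 1, by omega⟩
  rw [neg_binomAlt_succ]
  have hN : (0 : ℝ) < (N : ℝ) + 1 := by positivity
  have hP := le_binomPartialProd hβ0 hβ1 N
  have e : ((N + 1 : ℕ) : ℝ) = (N : ℝ) + 1 := by push_cast; ring
  rw [e]
  calc β * Real.exp (-(β / (1 - β) + β)) * ((N : ℝ) + 1) ^ (-(1 + β))
      = β / ((N : ℝ) + 1) * (Real.exp (-(β / (1 - β) + β)) * ((N : ℝ) + 1) ^ (-β)) := by
        rw [show -(1 + β) = -1 + -β by ring, Real.rpow_add hN, Real.rpow_neg_one]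
        ring
    _ ≤ β / ((N : ℝ) + 1) * binomPartialProd β N := mul_le_mul_of_nonneg_left hP (by positivity)

/-! ### The series for `-(-Δ)^β_{0,x}` -/

/-- `p₀(x) = 0` for `x ≠ 0`. [folklore] -/
theorem srwLaw_zero_of_ne {x : Site d} (hx : x ≠ 0) : srwLaw d 0 x = 0 := by
  rw [srwLaw_zero_apply, if_neg hx]

/-- `-(-Δ)^β_{0,x} = Σ_n (2d)^β (-(-1)ⁿ(β choose n)) pₙ(x)` (`d ≥ 1`, `0 < β < 1`), from the
binomial series and `pₙ(-x) = pₙ(x)`. [cite: Slade2017, §2.1.1 display (2.5)] -/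
theorem hasSum_neg_fracLaplacianZd (hd : 1 ≤ d) {β : ℝ} (hβ0 : 0 < β) (hβ1 : β < 1) (x : Site d) :
    HasSum (fun n => (2 * d : ℝ) ^ β * (-binomAlt β n) * srwLaw d n x) (-fracLaplacianZd d β 0 x) := by
  have h := (hasSum_fracLaplacianZd hd hβ0 hβ1 0 x).neg
  have e : (fun n => (2 * d : ℝ) ^ β * (-binomAlt β n) * srwLaw d n x) =
      fun n => -((2 * d : ℝ) ^ β * binomAlt β n * srwLaw d n (0 - x)) := by
    funext n
    rw [zero_sub, srwLaw_neg hd]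
    ring
  rw [e]
  exact h

/-- The terms of that series are nonnegative when `x ≠ 0`. [folklore] -/
theorem term_nonneg (hd : 1 ≤ d) {β : ℝ} (hβ0 : 0 < β) (hβ1 : β < 1) {x : Site d} (hx : x ≠ 0)
    (n : ℕ) : 0 ≤ (2 * d : ℝ) ^ β * (-binomAlt β n) * srwLaw d n x := by
  have hd' : (0 : ℝ) ≤ 2 * d := by positivity
  rcases n with _ | n
  · rw [srwLaw_zero_of_ne hx, mul_zero]
  · exact mul_nonneg (mul_nonneg (Real.rpow_nonneg hd' β) (by linarith [binomAlt_succ_neg hβ0 hβ1 n]))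
      (srwLaw_nonneg _ _)

/-! ### Geometry of `x`: a largest coordinate -/

/-- A largest coordinate `j` of `x ∈ ℤ^d` (`d ≥ 1`): `x_i² ≤ x_j²` for all `i`; hence
`|x|² ≤ d x_j²` and `|x_j| ≤ Σ_i |x_i|`. [folklore] -/
theorem exists_max_coord (hd : 1 ≤ d) (x : Site d) :
    ∃ j : Fin d, euclidNorm x ^ 2 ≤ d * ((x j : ℤ) : ℝ) ^ 2 ∧ |((x j : ℤ) : ℝ)| ≤ ∑ i, |((x i : ℤ) : ℝ)| := by
  obtain ⟨j, -, hj⟩ := Finset.exists_max_image Finset.univ (fun i : Fin d => ((x i : ℤ) : ℝ) ^ 2)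
    ⟨⟨0, hd⟩, Finset.mem_univ _⟩
  refine ⟨j, ?_, ?_⟩
  · rw [euclidNorm, Real.sq_sqrt (Finset.sum_nonneg fun i _ => sq_nonneg _)]
    calc ∑ i, ((x i : ℤ) : ℝ) ^ 2 ≤ ∑ _i : Fin d, ((x j : ℤ) : ℝ) ^ 2 :=
          Finset.sum_le_sum fun i _ => hj i (Finset.mem_univ i)
      _ = d * ((x j : ℤ) : ℝ) ^ 2 := by simp
  · exact Finset.single_le_sum (f := fun i => |((x i : ℤ) : ℝ)|) (fun i _ => abs_nonneg _)
      (Finset.mem_univ j)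

/-- `(Σ_i |x_i|)² ≤ d |x|²` (Cauchy–Schwarz). [folklore] -/
theorem sum_abs_sq_le (x : Site d) : (∑ i, |((x i : ℤ) : ℝ)|) ^ 2 ≤ d * euclidNorm x ^ 2 := by
  rw [euclidNorm, Real.sq_sqrt (Finset.sum_nonneg fun i _ => sq_nonneg _)]
  have h := sq_sum_le_card_mul_sum_sq (s := Finset.univ) (f := fun i : Fin d => |((x i : ℤ) : ℝ)|)
  simp only [Finset.card_univ, Fintype.card_fin, sq_abs] at h
  exact h

/-! ### The upper bound -/

/-- The elementary sum behind the upper bound: for `γ > 1` and `A ≥ 1`,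
`Σ_{1 ≤ n < M} n^{-γ} e^{-A/n} ≤ (2(q/e)^q + 2^{γ-1}/(γ-1)) A^{1-γ}` uniformly in `M` (`q = γ+1`):
for `n ≤ ⌊A⌋` use `e^{-u} ≤ (q/e)^q u^{-q}`, for `n > ⌊A⌋` drop the exponential and sum the
`p`-series tail. [cite: Slade2017, Lemma 2.1.1 (proof, upper bound)] -/
theorem sum_range_rpow_mul_exp_le {γ A : ℝ} (hγ : 1 < γ) (hA : 1 ≤ A) (M : ℕ) :
    ∑ n ∈ Finset.range M, (if n = 0 then (0 : ℝ) else (n : ℝ) ^ (-γ) * Real.exp (-(A / n))) ≤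
      (2 * ((γ + 1) / Real.exp 1) ^ (γ + 1) + 2 ^ (γ - 1) / (γ - 1)) * A ^ (1 - γ) := by
  have hA0 : 0 < A := by linarith
  set q : ℝ := γ + 1 with hq
  have hq0 : 0 < q := by rw [hq]; linarith
  set Cq : ℝ := (q / Real.exp 1) ^ q with hCq
  have hCq0 : 0 ≤ Cq := by positivity
  set N := ⌊A⌋₊ with hN
  have hN1 : 1 ≤ N := Nat.le_floor (by simpa using hA)
  have hN1' : (1 : ℝ) ≤ N := by exact_mod_cast hN1
  have hNA : (N : ℝ) ≤ A := Nat.floor_le hA0.le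
  have hAN : A / 2 ≤ N := by
    have := Nat.lt_floor_add_one A
    rw [← hN] at this
    linarith
  set t : ℕ → ℝ := fun n => if n = 0 then (0 : ℝ) else (n : ℝ) ^ (-γ) * Real.exp (-(A / n)) with ht
  have ht0 : ∀ n, 0 ≤ t n := fun n => by
    simp only [ht]
    split_ifs
    · exact le_rfl
    · exact mul_nonneg (Real.rpow_nonneg (Nat.cast_nonneg n) _) (Real.exp_pos _).le
  -- bound 1: `t n ≤ Cq A^{-q} n`
  have hb1 : ∀ n : ℕ, t n ≤ Cq * A ^ (-q) * n := by
    intro n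
    rcases Nat.eq_zero_or_pos n with hn | hn
    · subst hn
      simp [ht]
    simp only [ht, if_neg hn.ne']
    have hn' : (0 : ℝ) < n := by exact_mod_cast hn
    have hs : 0 < A / n := by positivity
    have hkey := rpow_mul_exp_neg_le hs hq0
    have hexp : Real.exp (-(A / n)) ≤ Cq * (A / n) ^ (-q) := by
      rw [Real.rpow_neg hs.le, ← div_eq_mul_inv, le_div_iff₀ (Real.rpow_pos_of_pos hs q), mul_comm]
      exact hkey
    have e3 : (A / n) ^ (-q) = A ^ (-q) * (n : ℝ) ^ q := by
      rw [Real.div_rpow hA0.le hn'.le, Real.rpow_neg hn'.le, div_inv_eq_mul]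
    calc (n : ℝ) ^ (-γ) * Real.exp (-(A / n)) ≤ (n : ℝ) ^ (-γ) * (Cq * (A / n) ^ (-q)) :=
          mul_le_mul_of_nonneg_left hexp (Real.rpow_nonneg hn'.le _)
      _ = Cq * A ^ (-q) * ((n : ℝ) ^ (-γ) * (n : ℝ) ^ q) := by
          rw [e3]
          ring
      _ = Cq * A ^ (-q) * n := by
          rw [← Real.rpow_add hn', show -γ + q = 1 by rw [hq]; ring, Real.rpow_one]
  -- bound 2: `t (k+1) ≤ (k+1)^{-γ}`
  have hb2 : ∀ k : ℕ, t (k + 1) ≤ ((k : ℝ) + 1) ^ (-γ) := by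
    intro k
    simp only [ht, Nat.add_eq_zero_iff, one_ne_zero, and_false, if_false]
    push_cast
    have h1 : Real.exp (-(A / ((k : ℝ) + 1))) ≤ 1 := by
      rw [Real.exp_le_one_iff, neg_nonpos]
      positivity
    have h2 : 0 ≤ ((k : ℝ) + 1) ^ (-γ) := Real.rpow_nonneg (by positivity) _
    nlinarith
  -- extend the range to `N + 1 + M` and split
  have hsub : Finset.range M ⊆ Finset.range (N + 1 + M) := Finset.range_subset_range.2 (by omega)
  have hsplit : ∑ n ∈ Finset.range (N + 1 + M), t n =
      ∑ n ∈ Finset.range (N + 1), t n + ∑ k ∈ Finset.Ico N (N + M), t (k + 1) := by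
    rw [Finset.sum_Ico_add' t N (N + M) 1, Finset.range_eq_Ico, Finset.range_eq_Ico,
      show N + M + 1 = N + 1 + M by omega]
    exact (Finset.sum_Ico_consecutive t (Nat.zero_le (N + 1)) (by omega : N + 1 ≤ N + 1 + M)).symm
  have hpart1 : ∑ n ∈ Finset.range (N + 1), t n ≤ 2 * Cq * A ^ (1 - γ) := by
    calc ∑ n ∈ Finset.range (N + 1), t n ≤ ∑ n ∈ Finset.range (N + 1), Cq * A ^ (-q) * N :=
          Finset.sum_le_sum fun n hn => (hb1 n).trans (by
            have : (n : ℝ) ≤ N := by exact_mod_cast Nat.lt_succ_iff.1 (Finset.mem_range.1 hn)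
            exact mul_le_mul_of_nonneg_left this (by positivity))
      _ = ((N : ℝ) + 1) * N * (Cq * A ^ (-q)) := by
          rw [Finset.sum_const, Finset.card_range, nsmul_eq_mul]
          push_cast
          ring
      _ ≤ (2 * A ^ 2) * (Cq * A ^ (-q)) := by
          refine mul_le_mul_of_nonneg_right ?_ (by positivity)
          nlinarith
      _ = 2 * Cq * A ^ (1 - γ) := by
          have : A ^ (2 : ℕ) * A ^ (-q) = A ^ (1 - γ) := by
            rw [← Real.rpow_natCast, ← Real.rpow_add hA0]
            congr 1
            rw [hq]
            push_cast
            ring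
          calc 2 * A ^ 2 * (Cq * A ^ (-q)) = 2 * Cq * (A ^ 2 * A ^ (-q)) := by ring
            _ = _ := by rw [this]
  have hpart2 : ∑ k ∈ Finset.Ico N (N + M), t (k + 1) ≤ 2 ^ (γ - 1) / (γ - 1) * A ^ (1 - γ) := by
    have h1 : ∑ k ∈ Finset.Ico N (N + M), t (k + 1) ≤ ∑ k ∈ Finset.Ico N (N + M), ((k : ℝ) + 1) ^ (-γ) :=
      Finset.sum_le_sum fun k _ => hb2 k
    have h2 := sum_Ico_succ_rpow_le_of_lt (e := -γ) (by linarith) (N := N + M) hN1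
    have h3 : (N : ℝ) ^ (-γ + 1) ≤ (A / 2) ^ (-γ + 1) :=
      Real.rpow_le_rpow_of_nonpos (by positivity) hAN (by linarith)
    have h4 : (A / 2) ^ (-γ + 1) = 2 ^ (γ - 1) * A ^ (1 - γ) := by
      rw [Real.div_rpow hA0.le (by norm_num), show -γ + 1 = 1 - γ by ring, div_eq_mul_inv,
        ← Real.rpow_neg (by norm_num : (0 : ℝ) ≤ 2), show -(1 - γ) = γ - 1 by ring, mul_comm]
    have hγ1 : 0 < -(-γ + 1) := by linarith
    calc ∑ k ∈ Finset.Ico N (N + M), t (k + 1) ≤ (N : ℝ) ^ (-γ + 1) / (-(-γ + 1)) := h1.trans h2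
      _ ≤ (A / 2) ^ (-γ + 1) / (-(-γ + 1)) := div_le_div_of_nonneg_right h3 hγ1.le
      _ = 2 ^ (γ - 1) / (γ - 1) * A ^ (1 - γ) := by
          rw [h4, show -(-γ + 1) = γ - 1 by ring]
          ring
  calc ∑ n ∈ Finset.range M, t n ≤ ∑ n ∈ Finset.range (N + 1 + M), t n :=
        Finset.sum_le_sum_of_subset_of_nonneg hsub fun n _ _ => ht0 n
    _ = _ := hsplit
    _ ≤ 2 * Cq * A ^ (1 - γ) + 2 ^ (γ - 1) / (γ - 1) * A ^ (1 - γ) := add_le_add hpart1 hpart2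
    _ = (2 * Cq + 2 ^ (γ - 1) / (γ - 1)) * A ^ (1 - γ) := by ring

/-- **Lemma 2.1.1, upper bound**: for `d ≥ 1`, `0 < β < 1` there are `C, R` with
`-(-Δ)^β_{0,x} ≤ C |x|^{-d-2β}` whenever `|x| ≥ R`. [cite: Slade2017, Lemma 2.1.1] -/
theorem exists_neg_fracLaplacianZd_le (hd : 1 ≤ d) {β : ℝ} (hβ0 : 0 < β) (hβ1 : β < 1) :
    ∃ C R : ℝ, 0 < C ∧ 0 < R ∧ ∀ x : Site d, R ≤ euclidNorm x →
      -fracLaplacianZd d β 0 x ≤ C * euclidNorm x ^ (-((d : ℝ) + 2 * β)) := by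
  have hd' : (0 : ℝ) < d := by exact_mod_cast hd
  obtain ⟨CG, hCG0, hCG⟩ := exists_srwLaw_gaussian_upper hd
  set γ : ℝ := 1 + β + (d : ℝ) / 2 with hγ
  have hγ1 : 1 < γ := by rw [hγ]; linarith
  set K : ℝ := 2 * ((γ + 1) / Real.exp 1) ^ (γ + 1) + 2 ^ (γ - 1) / (γ - 1) with hK
  have hK0 : 0 < K := by
    have : 0 < γ - 1 := by linarith
    positivity
  set C₀ : ℝ := (2 * d : ℝ) ^ β * β * CG with hC₀
  have hC₀0 : 0 < C₀ := by positivity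
  refine ⟨C₀ * K * (8 * (d : ℝ)) ^ (β + (d : ℝ) / 2), Real.sqrt (8 * d), by positivity, by positivity,
    fun x hx => ?_⟩
  -- a largest coordinate and `A = x_j²/8 ≥ 1`
  obtain ⟨j, hj, -⟩ := exists_max_coord hd x
  have hR2 : 8 * (d : ℝ) ≤ euclidNorm x ^ 2 := by
    have h := Real.sq_sqrt (by positivity : (0 : ℝ) ≤ 8 * d)
    nlinarith [hx, Real.sqrt_nonneg (8 * (d : ℝ)), euclidNorm_nonneg x]
  set a : ℝ := ((x j : ℤ) : ℝ) ^ 2 with ha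
  set A : ℝ := a / 8 with hA
  have hAx : euclidNorm x ^ 2 / (8 * d) ≤ A := by
    rw [hA, div_le_div_iff₀ (by positivity) (by norm_num)]
    nlinarith
  have hA1 : 1 ≤ A := le_trans (by rw [le_div_iff₀ (by positivity)]; linarith) hAx
  have hA0 : 0 < A := by linarith
  have hxnorm : 0 < euclidNorm x := by
    by_contra h
    push Not at h
    have h0 : euclidNorm x = 0 := le_antisymm h (euclidNorm_nonneg x)
    rw [h0] at hR2
    linarith
  have hx0 : x ≠ 0 := by
    intro h0
    rw [h0] at hxnorm
    simp [euclidNorm] at hxnorm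
  -- termwise majorant
  set f : ℕ → ℝ := fun n => (2 * d : ℝ) ^ β * (-binomAlt β n) * srwLaw d n x with hf
  set t : ℕ → ℝ := fun n => if n = 0 then (0 : ℝ) else (n : ℝ) ^ (-γ) * Real.exp (-(A / n)) with ht
  have hft : ∀ n, f n ≤ C₀ * t n := by
    intro n
    rcases Nat.eq_zero_or_pos n with hn | hn
    · subst hn
      simp [hf, ht, srwLaw_zero_of_ne hx0]
    have hn' : (0 : ℝ) < n := by exact_mod_cast hn
    simp only [hf, ht, if_neg hn.ne']
    have h1 : -binomAlt β n ≤ β * (n : ℝ) ^ (-(1 + β)) := neg_binomAlt_le hβ0.le hβ1 hn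
    have h2 := hCG n hn x j
    have h3 : 0 ≤ -binomAlt β n := by
      obtain ⟨m, rfl⟩ : ∃ m, n = m + 1 := ⟨n - 1, by omega⟩
      linarith [binomAlt_succ_neg hβ0 hβ1 m]
    have h4 : (2 * d : ℝ) ^ β * (-binomAlt β n) * srwLaw d n x ≤
        (2 * d : ℝ) ^ β * (β * (n : ℝ) ^ (-(1 + β))) *
          (CG * (n : ℝ) ^ (-((d : ℝ) / 2)) * Real.exp (-(((x j : ℤ) : ℝ) ^ 2 / (8 * n)))) :=
      mul_le_mul (mul_le_mul_of_nonneg_left h1 (by positivity)) h2 (srwLaw_nonneg n x) (by positivity)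
    refine h4.trans (le_of_eq ?_)
    have e1 : (n : ℝ) ^ (-(1 + β)) * (n : ℝ) ^ (-((d : ℝ) / 2)) = (n : ℝ) ^ (-γ) := by
      rw [← Real.rpow_add hn']
      congr 1
      rw [hγ]
      ring
    have e2 : ((x j : ℤ) : ℝ) ^ 2 / (8 * n) = A / n := by
      rw [hA, ha]
      field_simp
    rw [e2, hC₀, ← e1]
    ring
  -- the sum bound
  have hS := hasSum_neg_fracLaplacianZd hd hβ0 hβ1 x
  have hbound : -fracLaplacianZd d β 0 x ≤ C₀ * (K * A ^ (1 - γ)) := by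
    refine hasSum_le_of_sum_le hS fun s => ?_
    calc ∑ n ∈ s, f n ≤ ∑ n ∈ Finset.range ((s.sup id) + 1), f n :=
          Finset.sum_le_sum_of_subset_of_nonneg (Finset.subset_range_sup_succ s)
            fun n _ _ => term_nonneg hd hβ0 hβ1 hx0 n
      _ ≤ ∑ n ∈ Finset.range ((s.sup id) + 1), C₀ * t n := Finset.sum_le_sum fun n _ => hft n
      _ = C₀ * ∑ n ∈ Finset.range ((s.sup id) + 1), t n := by rw [Finset.mul_sum]
      _ ≤ C₀ * (K * A ^ (1 - γ)) :=
          mul_le_mul_of_nonneg_left (sum_range_rpow_mul_exp_le hγ1 hA1 _) hC₀0.le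
  -- `A^{1-γ} ≤ (8d)^{β+d/2} |x|^{-(d+2β)}`
  have hApow : A ^ (1 - γ) ≤ (8 * (d : ℝ)) ^ (β + (d : ℝ) / 2) * euclidNorm x ^ (-((d : ℝ) + 2 * β)) := by
    have h1 : A ^ (1 - γ) ≤ (euclidNorm x ^ 2 / (8 * d)) ^ (1 - γ) :=
      Real.rpow_le_rpow_of_nonpos (by positivity) hAx (by linarith)
    refine h1.trans (le_of_eq ?_)
    rw [Real.div_rpow (by positivity) (by positivity), show (1 : ℝ) - γ = -(β + (d : ℝ) / 2) by rw [hγ]; ring,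
      Real.rpow_neg (by positivity : (0 : ℝ) ≤ 8 * d), div_inv_eq_mul, mul_comm]
    congr 1
    rw [show euclidNorm x ^ 2 = euclidNorm x ^ (2 : ℝ) by norm_cast, ← Real.rpow_mul (euclidNorm_nonneg x)]
    congr 1
    ring
  calc -fracLaplacianZd d β 0 x ≤ C₀ * (K * A ^ (1 - γ)) := hbound
    _ ≤ C₀ * (K * ((8 * (d : ℝ)) ^ (β + (d : ℝ) / 2) * euclidNorm x ^ (-((d : ℝ) + 2 * β)))) := by
        gcongr
    _ = _ := by ring

/-! ### The lower bound: binomial weights of the lazy window -/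

/-- `Σ_{n ≤ M} (n choose m) 2^{-n} ≤ 2` for all `M, m` (induction on `M` via Pascal's rule; the
full series is `Σ_n (n choose m)2^{-n} = 2`). [folklore] -/
theorem sum_range_choose_div_two_pow_le_two (M m : ℕ) :
    ∑ n ∈ Finset.range (M + 1), ((n.choose m : ℕ) : ℝ) / 2 ^ n ≤ 2 := by
  induction M generalizing m with
  | zero =>
    rw [Finset.sum_range_one, pow_zero, div_one]
    rcases m with _ | m
    · simp
    · simp
  | succ M ih =>
    rw [Finset.sum_range_succ']
    rcases m with _ | m
    · simp only [Nat.choose_zero_right, Nat.cast_one, pow_zero, div_one]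
      have h := sum_geometric_two_le (M + 2)
      rw [Finset.sum_range_succ'] at h
      simp only [pow_zero] at h
      have e : ∀ n : ℕ, (1 : ℝ) / 2 ^ (n + 1) = (1 / 2) ^ (n + 1) := fun n => by
        rw [div_pow, one_pow]
      simp_rw [e]
      linarith
    · simp only [Nat.choose_zero_succ, Nat.cast_zero, zero_div, add_zero, Nat.choose_succ_succ,
        Nat.cast_add, pow_succ]
      have e : ∀ n : ℕ, (((n.choose m : ℕ) : ℝ) + ((n.choose (m + 1) : ℕ) : ℝ)) / (2 ^ n * 2) =
          (((n.choose m : ℕ) : ℝ) / 2 ^ n) / 2 + (((n.choose (m + 1) : ℕ) : ℝ) / 2 ^ n) / 2 := by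
        intro n
        ring
      simp_rw [e]
      rw [Finset.sum_add_distrib, ← Finset.sum_div, ← Finset.sum_div]
      linarith [ih m, ih (m + 1)]

/-- `(n choose m) ≤ (4/3)ⁿ 3^m` (the term `k = m` of `(1/3 + 1)ⁿ = Σ_k (n choose k) 3^{-k}`).
[folklore] -/
theorem choose_le_pow_mul_pow (n m : ℕ) : ((n.choose m : ℕ) : ℝ) ≤ (4 / 3 : ℝ) ^ n * 3 ^ m := by
  have h : (1 / 3 : ℝ) ^ m * ((n.choose m : ℕ) : ℝ) ≤ (1 / 3 + 1) ^ n := by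
    rw [add_pow]
    by_cases hm : m ≤ n
    · have := Finset.single_le_sum (f := fun k => (1 / 3 : ℝ) ^ k * 1 ^ (n - k) * ((n.choose k : ℕ) : ℝ))
        (fun k _ => by positivity) (Finset.mem_range.2 (Nat.lt_succ_of_le hm))
      simpa using this
    · rw [Nat.choose_eq_zero_of_lt (not_le.1 hm)]
      simp only [Nat.cast_zero, mul_zero]
      exact Finset.sum_nonneg fun k _ => by positivity
  calc ((n.choose m : ℕ) : ℝ) = ((1 / 3 : ℝ) ^ m * ((n.choose m : ℕ) : ℝ)) * 3 ^ m := by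
        rw [one_div, inv_pow]
        field_simp
    _ ≤ (1 / 3 + 1) ^ n * 3 ^ m := mul_le_mul_of_nonneg_right h (by positivity)
    _ = (4 / 3 : ℝ) ^ n * 3 ^ m := by norm_num

/-- **The binomial weights are exponentially small below the window**: for `m < L` and `n ≥ 4L`,
`(n choose m) 2^{-n} ≤ (48/81)^L`. [folklore] -/
theorem choose_div_two_pow_le {L m n : ℕ} (hm : m < L) (hn : 4 * L ≤ n) :
    ((n.choose m : ℕ) : ℝ) / 2 ^ n ≤ (48 / 81 : ℝ) ^ L := by
  have h1 := choose_le_pow_mul_pow n m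
  have h2 : ((n.choose m : ℕ) : ℝ) / 2 ^ n ≤ (2 / 3 : ℝ) ^ n * 3 ^ m := by
    rw [div_le_iff₀ (by positivity)]
    calc ((n.choose m : ℕ) : ℝ) ≤ (4 / 3 : ℝ) ^ n * 3 ^ m := h1
      _ = (2 / 3 : ℝ) ^ n * 3 ^ m * 2 ^ n := by
          rw [show (4 / 3 : ℝ) = 2 / 3 * 2 by norm_num, mul_pow]
          ring
  have h3 : (2 / 3 : ℝ) ^ n ≤ (2 / 3) ^ (4 * L) := pow_le_pow_of_le_one (by norm_num) (by norm_num) hn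
  have h4 : (3 : ℝ) ^ m ≤ 3 ^ L := pow_le_pow_right₀ (by norm_num) hm.le
  calc ((n.choose m : ℕ) : ℝ) / 2 ^ n ≤ (2 / 3 : ℝ) ^ n * 3 ^ m := h2
    _ ≤ (2 / 3 : ℝ) ^ (4 * L) * 3 ^ L := mul_le_mul h3 h4 (by positivity) (by positivity)
    _ = (48 / 81 : ℝ) ^ L := by
        rw [pow_mul, ← mul_pow]
        norm_num

/-- Extending the binomial sum in `p^L_n` to a longer range (the added coefficients vanish).
[folklore] -/
theorem lazyLaw_eq_sum_range_of_le {n K : ℕ} (hnK : n ≤ K) (x : Site d) :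
    lazyLaw d n x = ∑ m ∈ Finset.range (K + 1), (((n.choose m : ℕ) : ℝ) / 2 ^ n) * srwLaw d m x := by
  unfold lazyLaw
  refine Finset.sum_subset (Finset.range_subset_range.2 (by omega)) fun m hmK hmn => ?_
  have h : n < m := by
    simp only [Finset.mem_range, not_lt] at hmn hmK
    omega
  rw [Nat.choose_eq_zero_of_lt h]
  simp

/-- **The lazy window as a binomial mixture**:
`Σ_{n=4L}^{8L} p^L_n(x) = Σ_{m ≤ 8L} W_m p_m(x)` with `W_m = Σ_{n=4L}^{8L} (n choose m)2^{-n}`.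
[folklore] -/
theorem sum_Icc_lazyLaw_eq (L : ℕ) (x : Site d) :
    ∑ n ∈ Finset.Icc (4 * L) (8 * L), lazyLaw d n x =
      ∑ m ∈ Finset.range (8 * L + 1),
        (∑ n ∈ Finset.Icc (4 * L) (8 * L), ((n.choose m : ℕ) : ℝ) / 2 ^ n) * srwLaw d m x := by
  rw [Finset.sum_congr rfl fun n hn => lazyLaw_eq_sum_range_of_le (Finset.mem_Icc.1 hn).2 x,
    Finset.sum_comm]
  refine Finset.sum_congr rfl fun m _ => ?_
  rw [Finset.sum_mul]

/-- `W_m ≤ 2`. [folklore] -/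
theorem weight_le_two (L m : ℕ) :
    ∑ n ∈ Finset.Icc (4 * L) (8 * L), ((n.choose m : ℕ) : ℝ) / 2 ^ n ≤ 2 := by
  refine le_trans (Finset.sum_le_sum_of_subset_of_nonneg (fun n hn => ?_) fun n _ _ => by positivity)
    (sum_range_choose_div_two_pow_le_two (8 * L) m)
  rw [Finset.mem_range]
  have := (Finset.mem_Icc.1 hn).2
  omega

/-- `W_m ≤ (4L+1)(48/81)^L` for `m < L`. [folklore] -/
theorem weight_le_of_lt {L m : ℕ} (hm : m < L) :
    ∑ n ∈ Finset.Icc (4 * L) (8 * L), ((n.choose m : ℕ) : ℝ) / 2 ^ n ≤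
      ((4 * L + 1 : ℕ) : ℝ) * (48 / 81 : ℝ) ^ L := by
  calc ∑ n ∈ Finset.Icc (4 * L) (8 * L), ((n.choose m : ℕ) : ℝ) / 2 ^ n
      ≤ ∑ _n ∈ Finset.Icc (4 * L) (8 * L), (48 / 81 : ℝ) ^ L :=
        Finset.sum_le_sum fun n hn => choose_div_two_pow_le hm (Finset.mem_Icc.1 hn).1
    _ = ((4 * L + 1 : ℕ) : ℝ) * (48 / 81 : ℝ) ^ L := by
        rw [Finset.sum_const, Nat.card_Icc, nsmul_eq_mul, show 8 * L + 1 - 4 * L = 4 * L + 1 by omega]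

/-- **Near-diagonal lower bound for simple random walk, summed over a window**: there are
`c, ε > 0` and `L₀` (depending on `d ≥ 1`) such that for `L ≥ L₀` and `Σ_j|x_j| ≤ ε√L`,
`Σ_{L ≤ m ≤ 8L} p_m(x) ≥ c L (8L)^{-d/2}` — the lower half of the [GT02] estimate in the window
`n ≍ |x|²` used by the printed proof, via the lazy walk. [cite: Slade2017, §2.1.1 display (2.10)
(lower bound) and Lemma 2.1.1 (proof, lower bound)] -/
theorem exists_sum_Ico_srwLaw_ge (hd : 1 ≤ d) :
    ∃ c ε : ℝ, 0 < c ∧ 0 < ε ∧ ∃ L₀ : ℕ, 1 ≤ L₀ ∧ ∀ L : ℕ, L₀ ≤ L → ∀ x : Site d,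
      (∑ j, |((x j : ℤ) : ℝ)|) ≤ ε * Real.sqrt L →
        c * (L : ℝ) * ((8 * L : ℕ) : ℝ) ^ (-((d : ℝ) / 2)) ≤ ∑ m ∈ Finset.Ico L (8 * L + 1), srwLaw d m x := by
  obtain ⟨cL, ε, hcL, hε, hlazy⟩ := exists_lazyLaw_ge hd
  -- `L^{1+d} (48/81)^L → 0`
  have hlim := tendsto_pow_const_mul_const_pow_of_abs_lt_one (1 + d)
    (r := (48 / 81 : ℝ)) (by rw [abs_of_pos (by norm_num)]; norm_num)
  have hev : ∀ᶠ L : ℕ in atTop, (L : ℝ) ^ (1 + d) * (48 / 81 : ℝ) ^ L < cL / (2 * 8 ^ d) :=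
    (tendsto_order.1 hlim).2 _ (by positivity)
  obtain ⟨L₁, hL₁⟩ := Filter.eventually_atTop.1 hev
  refine ⟨cL, ε, hcL, hε, max L₁ 1, le_max_right _ _, fun L hL x hx => ?_⟩
  have hL1 : 1 ≤ L := le_trans (le_max_right _ _) hL
  have hLL₁ : L₁ ≤ L := le_trans (le_max_left _ _) hL
  have hL0 : (0 : ℝ) < L := by exact_mod_cast hL1
  have hL1' : (1 : ℝ) ≤ L := by exact_mod_cast hL1
  have h8L : (1 : ℝ) ≤ ((8 * L : ℕ) : ℝ) := by push_cast; linarith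
  have h8L0 : (0 : ℝ) < ((8 * L : ℕ) : ℝ) := by linarith
  set P : ℝ := ((8 * L : ℕ) : ℝ) ^ (-((d : ℝ) / 2)) with hP
  have hP0 : 0 < P := Real.rpow_pos_of_pos h8L0 _
  -- the geometric error is small: `L (48/81)^L ≤ (cL/2) P`
  have hsmall : (L : ℝ) * (48 / 81 : ℝ) ^ L ≤ cL / 2 * P := by
    have h1 := (hL₁ L hLL₁).le
    -- `P ≥ (8L)^{-d} = 8^{-d} L^{-d}`
    have hP1 : ((8 : ℝ) ^ d * (L : ℝ) ^ d)⁻¹ ≤ P := by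
      rw [hP]
      have : ((8 * L : ℕ) : ℝ) ^ (-((d : ℝ) / 2)) ≥ ((8 * L : ℕ) : ℝ) ^ (-(d : ℝ)) :=
        Real.rpow_le_rpow_of_exponent_le h8L (by linarith [(by positivity : (0 : ℝ) ≤ d)])
      refine le_trans (le_of_eq ?_) this
      rw [Real.rpow_neg h8L0.le, Real.rpow_natCast]
      push_cast
      rw [mul_pow]
    have h2 : (L : ℝ) * (48 / 81 : ℝ) ^ L * ((8 : ℝ) ^ d * (L : ℝ) ^ d) ≤ cL / 2 := by
      calc (L : ℝ) * (48 / 81 : ℝ) ^ L * ((8 : ℝ) ^ d * (L : ℝ) ^ d)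
          = ((L : ℝ) ^ (1 + d) * (48 / 81 : ℝ) ^ L) * 8 ^ d := by ring
        _ ≤ cL / (2 * 8 ^ d) * 8 ^ d := mul_le_mul_of_nonneg_right h1 (by positivity)
        _ = cL / 2 := by field_simp
    have h3 : 0 < (8 : ℝ) ^ d * (L : ℝ) ^ d := by positivity
    calc (L : ℝ) * (48 / 81 : ℝ) ^ L = ((L : ℝ) * (48 / 81 : ℝ) ^ L * ((8 : ℝ) ^ d * (L : ℝ) ^ d)) *
          ((8 : ℝ) ^ d * (L : ℝ) ^ d)⁻¹ := by field_simp
      _ ≤ (cL / 2) * ((8 : ℝ) ^ d * (L : ℝ) ^ d)⁻¹ := mul_le_mul_of_nonneg_right h2 (by positivity)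
      _ ≤ cL / 2 * P := mul_le_mul_of_nonneg_left hP1 (by positivity)
  -- lower bound on the window sum of the lazy walk
  have hwin : (((4 * L + 1 : ℕ) : ℝ)) * (cL * P) ≤ ∑ n ∈ Finset.Icc (4 * L) (8 * L), lazyLaw d n x := by
    have hcard : (Finset.Icc (4 * L) (8 * L)).card = 4 * L + 1 := by
      rw [Nat.card_Icc]
      omega
    rw [← hcard, ← nsmul_eq_mul, show (Finset.Icc (4 * L) (8 * L)).card • (cL * P) =
      ∑ _n ∈ Finset.Icc (4 * L) (8 * L), cL * P by rw [Finset.sum_const]]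
    refine Finset.sum_le_sum fun n hn => ?_
    obtain ⟨hn1, hn2⟩ := Finset.mem_Icc.1 hn
    have hn0 : 1 ≤ n := by omega
    have hn0' : (0 : ℝ) < n := by exact_mod_cast hn0
    have hxn : (∑ j, |((x j : ℤ) : ℝ)|) ≤ ε * Real.sqrt n := by
      refine hx.trans (mul_le_mul_of_nonneg_left (Real.sqrt_le_sqrt (by exact_mod_cast (by omega : L ≤ n))) hε.le)
    have h1 := hlazy n hn0 x hxn
    have h2 : P ≤ (n : ℝ) ^ (-((d : ℝ) / 2)) :=
      Real.rpow_le_rpow_of_nonpos hn0' (by exact_mod_cast hn2) (by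
        rw [neg_nonpos]; positivity)
    calc cL * P ≤ cL * (n : ℝ) ^ (-((d : ℝ) / 2)) := mul_le_mul_of_nonneg_left h2 hcL.le
      _ ≤ lazyLaw d n x := h1
  -- rewrite the window sum as a mixture and split at `m = L`
  rw [sum_Icc_lazyLaw_eq L x, Finset.range_eq_Ico,
    ← Finset.sum_Ico_consecutive _ (Nat.zero_le L) (by omega : L ≤ 8 * L + 1)] at hwin
  set W : ℕ → ℝ := fun m => ∑ n ∈ Finset.Icc (4 * L) (8 * L), ((n.choose m : ℕ) : ℝ) / 2 ^ n with hW
  have hW0 : ∀ m, 0 ≤ W m := fun m => Finset.sum_nonneg fun n _ => by positivity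
  have hlow : ∑ m ∈ Finset.Ico 0 L, W m * srwLaw d m x ≤ (L : ℝ) * (((4 * L + 1 : ℕ) : ℝ) * (48 / 81 : ℝ) ^ L) := by
    calc ∑ m ∈ Finset.Ico 0 L, W m * srwLaw d m x
        ≤ ∑ _m ∈ Finset.Ico 0 L, ((4 * L + 1 : ℕ) : ℝ) * (48 / 81 : ℝ) ^ L :=
          Finset.sum_le_sum fun m hm => by
            have hmL : m < L := (Finset.mem_Ico.1 hm).2
            calc W m * srwLaw d m x ≤ W m * 1 :=
                  mul_le_mul_of_nonneg_left (srwLaw_le_one hd m x) (hW0 m)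
              _ ≤ ((4 * L + 1 : ℕ) : ℝ) * (48 / 81 : ℝ) ^ L := by
                  rw [mul_one]
                  exact weight_le_of_lt hmL
      _ = (L : ℝ) * (((4 * L + 1 : ℕ) : ℝ) * (48 / 81 : ℝ) ^ L) := by
          rw [Finset.sum_const, Nat.card_Ico, nsmul_eq_mul, Nat.sub_zero]
  have hhigh : ∑ m ∈ Finset.Ico L (8 * L + 1), W m * srwLaw d m x ≤
      2 * ∑ m ∈ Finset.Ico L (8 * L + 1), srwLaw d m x := by
    rw [Finset.mul_sum]
    refine Finset.sum_le_sum fun m _ => ?_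
    exact mul_le_mul_of_nonneg_right (weight_le_two L m) (srwLaw_nonneg m x)
  -- combine
  have hmain : (((4 * L + 1 : ℕ) : ℝ)) * (cL * P) - (L : ℝ) * (((4 * L + 1 : ℕ) : ℝ) * (48 / 81 : ℝ) ^ L) ≤
      2 * ∑ m ∈ Finset.Ico L (8 * L + 1), srwLaw d m x := by linarith
  have h4L : ((4 * L + 1 : ℕ) : ℝ) = 4 * L + 1 := by push_cast; ring
  rw [h4L] at hmain
  have hkey : (4 * (L : ℝ) + 1) * (cL / 2 * P) ≤ 2 * ∑ m ∈ Finset.Ico L (8 * L + 1), srwLaw d m x := by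
    have : (L : ℝ) * ((4 * L + 1) * (48 / 81 : ℝ) ^ L) ≤ (4 * (L : ℝ) + 1) * (cL / 2 * P) := by
      calc (L : ℝ) * ((4 * L + 1) * (48 / 81 : ℝ) ^ L) = (4 * (L : ℝ) + 1) * ((L : ℝ) * (48 / 81 : ℝ) ^ L) := by
            ring
        _ ≤ (4 * (L : ℝ) + 1) * (cL / 2 * P) := mul_le_mul_of_nonneg_left hsmall (by positivity)
    linarith
  nlinarith [hP0, hcL, hL0]

/-- `|x| ≤ Σ_j |x_j|`. [folklore] -/
theorem euclidNorm_le_sum_abs (x : Site d) : euclidNorm x ≤ ∑ i, |((x i : ℤ) : ℝ)| := by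
  rw [euclidNorm, Real.sqrt_le_left (Finset.sum_nonneg fun i _ => abs_nonneg _)]
  calc ∑ i, ((x i : ℤ) : ℝ) ^ 2 = ∑ i, |((x i : ℤ) : ℝ)| * |((x i : ℤ) : ℝ)| :=
        Finset.sum_congr rfl fun i _ => by rw [← sq, sq_abs]
    _ ≤ ∑ i, |((x i : ℤ) : ℝ)| * ∑ k, |((x k : ℤ) : ℝ)| :=
        Finset.sum_le_sum fun i _ => mul_le_mul_of_nonneg_left
          (Finset.single_le_sum (f := fun k => |((x k : ℤ) : ℝ)|) (fun k _ => abs_nonneg _)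
            (Finset.mem_univ i)) (abs_nonneg _)
    _ = (∑ i, |((x i : ℤ) : ℝ)|) ^ 2 := by rw [← Finset.sum_mul, sq]

/-- **Lemma 2.1.1, lower bound**: for `d ≥ 1`, `0 < β < 1` there are `c > 0` and `R` with
`-(-Δ)^β_{0,x} ≥ c |x|^{-d-2β}` whenever `|x| ≥ R`. [cite: Slade2017, Lemma 2.1.1] -/
theorem exists_le_neg_fracLaplacianZd (hd : 1 ≤ d) {β : ℝ} (hβ0 : 0 < β) (hβ1 : β < 1) :
    ∃ c R : ℝ, 0 < c ∧ 0 < R ∧ ∀ x : Site d, R ≤ euclidNorm x →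
      c * euclidNorm x ^ (-((d : ℝ) + 2 * β)) ≤ -fracLaplacianZd d β 0 x := by
  have hd' : (0 : ℝ) < d := by exact_mod_cast hd
  obtain ⟨cL, ε, hcL, hε, L₀, hL₀, hwin⟩ := exists_sum_Ico_srwLaw_ge hd
  set ca : ℝ := β * Real.exp (-(β / (1 - β) + β)) with hca
  have hca0 : 0 < ca := by positivity
  set s : ℝ := β + (d : ℝ) / 2 with hs
  have hs0 : 0 < s := by positivity
  set c : ℝ := (2 * d : ℝ) ^ β * (ca * cL / 8) * (16 * (d : ℝ) / ε ^ 2) ^ (-s) with hc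
  set R : ℝ := ε * Real.sqrt ((L₀ : ℝ) + 1) with hR
  have hR0 : 0 < R := by positivity
  refine ⟨c, R, by positivity, hR0, fun x hx => ?_⟩
  -- norms of `x`
  have hxpos : 0 < euclidNorm x := hR0.trans_le hx
  have hx0 : x ≠ 0 := by
    intro h0
    rw [h0] at hxpos
    simp [euclidNorm] at hxpos
  set N₁ : ℝ := ∑ j, |((x j : ℤ) : ℝ)| with hN₁
  have hN₁x : euclidNorm x ≤ N₁ := euclidNorm_le_sum_abs x
  have hN₁sq : N₁ ^ 2 ≤ d * euclidNorm x ^ 2 := sum_abs_sq_le x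
  set T : ℝ := (N₁ / ε) ^ 2 with hT
  have hT1 : (L₀ : ℝ) + 1 ≤ T := by
    have h1 : R / ε ≤ N₁ / ε := div_le_div_of_nonneg_right (hx.trans hN₁x) hε.le
    have h2 : R / ε = Real.sqrt ((L₀ : ℝ) + 1) := by rw [hR]; field_simp
    rw [h2] at h1
    have h3 := Real.sq_sqrt (by positivity : (0 : ℝ) ≤ (L₀ : ℝ) + 1)
    rw [hT]
    nlinarith [Real.sqrt_nonneg ((L₀ : ℝ) + 1)]
  have hT0 : 0 ≤ T := by positivity
  set L : ℕ := ⌈T⌉₊ with hL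
  have hTL : T ≤ L := Nat.le_ceil T
  have hLT : (L : ℝ) ≤ 2 * T := by
    have := Nat.ceil_lt_add_one hT0
    rw [← hL] at this
    have hL01 : (1 : ℝ) ≤ L₀ := by exact_mod_cast hL₀
    linarith
  have hL₀L : L₀ ≤ L := by
    have : (L₀ : ℝ) ≤ L := by linarith
    exact_mod_cast this
  have hL1 : 1 ≤ L := hL₀.trans hL₀L
  have hL0' : (0 : ℝ) < L := by exact_mod_cast hL1
  -- `|x|₁ ≤ ε √L`
  have hxL : N₁ ≤ ε * Real.sqrt L := by
    have h1 : N₁ = ε * Real.sqrt T := by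
      rw [hT, Real.sqrt_sq (by positivity)]
      field_simp
    rw [h1]
    exact mul_le_mul_of_nonneg_left (Real.sqrt_le_sqrt hTL) hε.le
  have hW := hwin L hL₀L x hxL
  -- compare the series with the window
  have hS := hasSum_neg_fracLaplacianZd hd hβ0 hβ1 x
  set f : ℕ → ℝ := fun n => (2 * d : ℝ) ^ β * (-binomAlt β n) * srwLaw d n x with hf
  have h8L0 : (0 : ℝ) < ((8 * L : ℕ) : ℝ) := by push_cast; linarith
  set Q : ℝ := ((8 * L : ℕ) : ℝ) ^ (-(1 + β)) with hQ
  have hQ0 : 0 < Q := Real.rpow_pos_of_pos h8L0 _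
  have hterm : ∀ m ∈ Finset.Ico L (8 * L + 1), (2 * d : ℝ) ^ β * (ca * Q) * srwLaw d m x ≤ f m := by
    intro m hm
    obtain ⟨hm1, hm2⟩ := Finset.mem_Ico.1 hm
    have hm0 : 1 ≤ m := hL1.trans hm1
    have hm0' : (0 : ℝ) < m := by exact_mod_cast hm0
    simp only [hf]
    refine mul_le_mul_of_nonneg_right (mul_le_mul_of_nonneg_left ?_ (by positivity)) (srwLaw_nonneg m x)
    have h1 := le_neg_binomAlt hβ0.le hβ1 hm0
    have h2 : Q ≤ (m : ℝ) ^ (-(1 + β)) :=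
      Real.rpow_le_rpow_of_nonpos hm0' (by exact_mod_cast (by omega : m ≤ 8 * L)) (by linarith)
    calc ca * Q ≤ ca * (m : ℝ) ^ (-(1 + β)) := mul_le_mul_of_nonneg_left h2 hca0.le
      _ ≤ -binomAlt β m := by rw [hca]; exact h1
  have h1 : ∑ m ∈ Finset.Ico L (8 * L + 1), f m ≤ -fracLaplacianZd d β 0 x :=
    sum_le_hasSum _ (fun m _ => term_nonneg hd hβ0 hβ1 hx0 m) hS
  have h2 : (2 * d : ℝ) ^ β * (ca * Q) * (cL * (L : ℝ) * ((8 * L : ℕ) : ℝ) ^ (-((d : ℝ) / 2))) ≤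
      ∑ m ∈ Finset.Ico L (8 * L + 1), f m := by
    calc (2 * d : ℝ) ^ β * (ca * Q) * (cL * (L : ℝ) * ((8 * L : ℕ) : ℝ) ^ (-((d : ℝ) / 2)))
        ≤ (2 * d : ℝ) ^ β * (ca * Q) * ∑ m ∈ Finset.Ico L (8 * L + 1), srwLaw d m x :=
          mul_le_mul_of_nonneg_left hW (by positivity)
      _ = ∑ m ∈ Finset.Ico L (8 * L + 1), (2 * d : ℝ) ^ β * (ca * Q) * srwLaw d m x := by
          rw [Finset.mul_sum]
      _ ≤ ∑ m ∈ Finset.Ico L (8 * L + 1), f m := Finset.sum_le_sum hterm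
  -- simplify the left-hand side: `Q · L · (8L)^{-d/2} = (8L)^{-s}/8`
  have h3 : Q * ((L : ℝ) * ((8 * L : ℕ) : ℝ) ^ (-((d : ℝ) / 2))) = ((8 * L : ℕ) : ℝ) ^ (-s) / 8 := by
    rw [hQ]
    have e1 : (L : ℝ) = ((8 * L : ℕ) : ℝ) ^ (1 : ℝ) / 8 := by
      rw [Real.rpow_one]
      push_cast
      ring
    rw [e1]
    have e2 : ((8 * L : ℕ) : ℝ) ^ (-(1 + β)) * (((8 * L : ℕ) : ℝ) ^ (1 : ℝ) / 8 * ((8 * L : ℕ) : ℝ) ^ (-((d : ℝ) / 2))) =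
        (((8 * L : ℕ) : ℝ) ^ (-(1 + β)) * ((8 * L : ℕ) : ℝ) ^ (1 : ℝ) * ((8 * L : ℕ) : ℝ) ^ (-((d : ℝ) / 2))) / 8 := by
      ring
    rw [e2, ← Real.rpow_add h8L0, ← Real.rpow_add h8L0]
    congr 2
    rw [hs]
    ring
  -- `(8L)^{-s} ≥ (16 d |x|²/ε²)^{-s} = (16d/ε²)^{-s} |x|^{-(d+2β)}`
  have h4 : (16 * (d : ℝ) / ε ^ 2) ^ (-s) * euclidNorm x ^ (-((d : ℝ) + 2 * β)) ≤ ((8 * L : ℕ) : ℝ) ^ (-s) := by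
    have hle : ((8 * L : ℕ) : ℝ) ≤ 16 * (d : ℝ) / ε ^ 2 * euclidNorm x ^ 2 := by
      push_cast
      have : T ≤ (d : ℝ) * euclidNorm x ^ 2 / ε ^ 2 := by
        rw [hT, div_pow, div_le_div_iff₀ (by positivity) (by positivity)]
        nlinarith [sq_nonneg ε]
      calc (8 : ℝ) * L ≤ 16 * T := by linarith
        _ ≤ 16 * ((d : ℝ) * euclidNorm x ^ 2 / ε ^ 2) := by linarith
        _ = 16 * (d : ℝ) / ε ^ 2 * euclidNorm x ^ 2 := by ring
    have h := Real.rpow_le_rpow_of_nonpos h8L0 hle (by linarith : -s ≤ 0)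
    refine le_trans (le_of_eq ?_) h
    rw [Real.mul_rpow (by positivity) (by positivity)]
    congr 1
    rw [show euclidNorm x ^ 2 = euclidNorm x ^ (2 : ℝ) by norm_cast, ← Real.rpow_mul (euclidNorm_nonneg x)]
    congr 1
    rw [hs]
    ring
  -- assemble
  have h5 : (2 * d : ℝ) ^ β * (ca * Q) * (cL * (L : ℝ) * ((8 * L : ℕ) : ℝ) ^ (-((d : ℝ) / 2))) =
      (2 * d : ℝ) ^ β * (ca * cL / 8) * ((8 * L : ℕ) : ℝ) ^ (-s) := by
    calc (2 * d : ℝ) ^ β * (ca * Q) * (cL * (L : ℝ) * ((8 * L : ℕ) : ℝ) ^ (-((d : ℝ) / 2)))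
        = (2 * d : ℝ) ^ β * (ca * cL) * (Q * ((L : ℝ) * ((8 * L : ℕ) : ℝ) ^ (-((d : ℝ) / 2)))) := by ring
      _ = _ := by rw [h3]; ring
  rw [h5] at h2
  calc c * euclidNorm x ^ (-((d : ℝ) + 2 * β))
      = (2 * d : ℝ) ^ β * (ca * cL / 8) * ((16 * (d : ℝ) / ε ^ 2) ^ (-s) * euclidNorm x ^ (-((d : ℝ) + 2 * β))) := by
        rw [hc]; ring
    _ ≤ (2 * d : ℝ) ^ β * (ca * cL / 8) * ((8 * L : ℕ) : ℝ) ^ (-s) :=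
        mul_le_mul_of_nonneg_left h4 (by positivity)
    _ ≤ ∑ m ∈ Finset.Ico L (8 * L + 1), f m := h2
    _ ≤ -fracLaplacianZd d β 0 x := h1

/-! ### Lemma 2.1.1 -/

/-- **Slade, Lemma 2.1.1, PROVED** (discharging the named fact `Slade2017_lem211` of
`RigorousRGSmallParameterSusceptibilityFormula.lean`): for `d ≥ 1` and `β ∈ (0,1)` there are
`c > 0` and `R` such that `c⁻¹|x|^{-d-2β} ≤ -(-Δ)^β_{0,x} ≤ c|x|^{-d-2β}` for all `x ∈ ℤ^d` with
`|x| ≥ R` ("as `|x| → ∞`, `-(-Δ)^β_{0,x} ≍ |x|^{-d-2β}`"), for the transcribed Fourier kernel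
`fracLaplacianZd`. Proof as printed — binomial series (2.5), the coefficient bounds (2.6), and
heat kernel bounds for simple random walk in the window `n ≍ |x|²` and beyond — with the
[GT02] input replaced by the Gaussian upper bound and the lazy-walk lower bound proved in
`RigorousRGSmallParameterLazyWalk.lean`. [cite: Slade2017, Lemma 2.1.1] -/
theorem Slade2017_lem211_holds : Slade2017_lem211 := by
  intro d hd β hβ0 hβ1
  obtain ⟨C, R₁, hC, -, hup⟩ := exists_neg_fracLaplacianZd_le hd hβ0 hβ1
  obtain ⟨c, R₂, hc, -, hlow⟩ := exists_le_neg_fracLaplacianZd hd hβ0 hβ1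
  refine ⟨max C c⁻¹, max R₁ R₂, lt_max_of_lt_left hC, fun x hx => ⟨?_, ?_⟩⟩
  · have h1 := hlow x (le_trans (le_max_right _ _) hx)
    have h2 : (max C c⁻¹)⁻¹ ≤ c := by
      rw [inv_le_comm₀ (lt_max_of_lt_left hC) hc]
      exact le_max_right _ _
    have h3 : 0 ≤ euclidNorm x ^ (-((d : ℝ) + 2 * β)) := Real.rpow_nonneg (euclidNorm_nonneg x) _
    exact le_trans (mul_le_mul_of_nonneg_right h2 h3) h1
  · have h1 := hup x (le_trans (le_max_left _ _) hx)
    have h3 : 0 ≤ euclidNorm x ^ (-((d : ℝ) + 2 * β)) := Real.rpow_nonneg (euclidNorm_nonneg x) _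
    exact h1.trans (mul_le_mul_of_nonneg_right (le_max_left _ _) h3)

end LongRangePhi4

end Literature.Barriers.CriticalPhenomena

end
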